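import Summits.QuantumFields.YangMills.Theorems.BalabanUVNodesN09AveragingOpenAtSmallFields
import HarnessLib

/-!
# S2β · (SUBM-m) (s2) «`DM` ONTO» — THE k-STEP CHART-READ (0.4) EML BLOCK AVERAGE HAS ONTO DERIVATIVE AT `0` UNDER THE LOOP GUARD AT EVERY LEVEL
# (generic `P : Params`, `SU(N)`; the chain rule over pub-ymgap N09's one-step onto ✓`fderiv_chartRead_avgFun_range_eq_top`, BY NAME)

Cell `ym3-torus` (YM ladder rung R3 = continuum `SU(2)` Yang–Mills on the three-torus at fixed lattice data — a RUNG: NOT d = 4, NOT infinite volume, NOT a mass gap,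
NOT Clay).  Width seat `ym3-torus-px13` (gen 25); crux `stmt-QuantumFields-20520` (`…Theses.UnitScaleTilt.FluctuationComparisonRegPrIntL`), LINE g18-1 S2β, organ GAP♯∘
⟸ (D♮) ∧ (F♮) ⟸ «CRIT♮» ⟸ «MULT♭» = CRIT-m♮ ∧ MULT♮ ∧ AVG₂♭ (px16 g21 ✓`…S2BetaCritPairOfMultiplier`); CRIT-m♮ ⟸ (SUBM-m) = (s1) strict differentiability ∧ (s2) ONTO
derivative ∧ (s3) level set ⊆ fibre of the charted descent (px5 g22 instance door `…S2BetaCritMOfSubmersion`).  THIS FILE: the qualitative conjunct (s2) is a THEOREM of the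
tree's own (0.4) averaging — `--kind proof --supports stmt-QuantumFields-20520 --as helper`, count-neutral, DEFINITION-FREE (0 `def`, 0 `instance`, 0 `notation`, 0 `sorry`).
OBJECTS (all CONSUMED BY NAME).  `Θ = expChart`, `Λ = logChart` of lit `HaarExponentialChart.IsChartRep` for `isChartRep_specialUnitaryGroup (n := Fin N)` (`𝔤 = 𝔰𝔲(N)`); the
(0.4) block averagings `av i := BlockAveraging.blockAvg expMeanLogSU`, their iterate `Ū^k = Averaging.iter av k` (lit `Setup`), the guard below `k` `Node00.SmallBelow av k U₀`;
pub-ymgap N09's ONE-STEP chart-read average `ψ_{W}(B)(c') = Λ(Ū(Θ^B(B)·W)(c')·Ū(W)(c')⁻¹)` (✓`contDiffAt_chartRead_avgFun`, ✓`fderiv_chartRead_avgFun_range_eq_top`).  The k-STEP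
chart-read average at `U₀ : GaugeField P 0 (SU N)` is written out in every statement: `Ψ_k(A)(c) = Λ(Ū^k(Θ^B(A)·U₀)(c) · Ū^k(U₀)(c)⁻¹)`, `A : PBond P 0 → 𝔤`, `c : PBond P k`.

WHAT IS PROVED (sorry-free).
* §1 bookkeeping: the translated chart is continuous and centred, `Ū^{k+1} = Ū ∘ Ū^k`.  §2 ★`continuousAt_iter_chart` — `A ↦ Ū^k(Θ^B(A)·U₀)` is continuous at `0`
  under the guard below `k`; `eventually_norm_rel_iter_lt` — near `A = 0` every relative coarse bond `Ū^k(Θ^B(A)·U₀)(c)·Ū^k(U₀)(c)⁻¹` is inside the inner radius of the log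
  chart; `expChart_chartRead_iter_mul` — there `Θ(Ψ_k(A)(c))·Ū^k(U₀)(c) = Ū^k(Θ^B(A)·U₀)(c)`.
* §3 ★★`chartRead_iter_succ_eventuallyEq` — THE FACTORISATION `Ψ_{k+1} =ᶠ[𝓝 0] ψ_{Ū^k(U₀)} ∘ Ψ_k`; `chartRead_iter_zero_eventuallyEq` — `Ψ_0 =ᶠ[𝓝 0] id`; `chartRead_iter_apply_zero`.
* §4 ★★★`contDiffAt_and_range_fderiv_chartRead_iter` (induction on `k`): under `k ≤ m + K` and the loop `α`-guard `dist1 (loopHol (Ū^i U₀) c idx) ≤ α` at every level `i < k`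
  (`α ≤ 1∕24`, `α < δ_N`, `157·α < L^{1−d}` — N09's displayed numerics, not optimised): `Ψ_k` is `C^∞` at `0` AND `range (fderiv ℝ Ψ_k 0) = ⊤`.  Readers:
  ★★★`range_fderiv_chartRead_iter_eq_top`, ★★★`surjective_fderiv_chartRead_iter`, ★★`hasStrictFDerivAt_chartRead_iter`, `contDiffAt_chartRead_iter` (guard-only).

HONEST.  Kernel calculus ∕ bookkeeping on the tree's OWN (0.4) averaging, composed BY NAME from pub-ymgap N07∕N09's one-step theorems; NO estimate of Bałaban's; the derivative
is not computed (no right inverse, no norm: RINV-cov ∕ MULT♮ ∕ AVG₂♭ are OTHER seats' letters, NOT touched); (s1)∕(s3), CRIT-m♮, «CRIT♮», (D♮)∕(F♮), GAP♯∘ (registry UNTOUCHED),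
the five REGISTERED stubs, S2β, crux 20520, 19936, 19200 and `YM3TorusSU2` are NOT proved; no summit statement is proved by a helper; rung R3 = SU(2) YM₃ on T³ at fixed lattice
data — NOT d = 4, NOT infinite volume, NOT a mass gap, NOT Clay; the Yang–Mills mass gap is NOT proved.  Axioms standard.

References: T. Bałaban, CMP **109** (1987) 249–301 [Balaban1987RG1] ((0.4), (0.8), (0.11) p.253); CMP **98** (1985) 17–51 [Balaban1985Averaging] (Prop. 3 (122)–(124) p.36:
the linearised averaging is onto); CMP **102** (1985) 277–309 [Balaban1985Variational] ((3) p.278, (44) p.285: the constraint `Ū^k = V` and its linearisation).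
-/

set_option autoImplicit false

noncomputable section

open scoped Matrix.Norms.L2Operator Topology
open Filter Set Function

namespace Summit.QuantumFields.YangMills.Theorems.FluctuationComparisonRegPrIntLS2BetaChartReadDescentOnto

open Literature.MathematicalPhysics.QuantumFieldTheory.Balaban1983to89
open Literature.MathematicalPhysics.QuantumFieldTheory.Balaban1983to89.HaarExponentialChart
open Literature.MathematicalPhysics.QuantumFieldTheory.Balaban1983to89.HaarExponentialChart.IsChartRep
open Literature.MathematicalPhysics.QuantumFieldTheory.Balaban1983to89.BlockAveraging (Small Idx avgFun loopHol blockAvg blockAvg_avg)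
open Literature.MathematicalPhysics.QuantumFieldTheory.Balaban1983to89.ExpMeanLog (expMeanLogSU deltaSU)
open Literature.MathematicalPhysics.QuantumFieldTheory.Balaban1983to89.Node00
open Literature.MathematicalPhysics.QuantumLattice (fundamentalRep fundamentalRep_apply)
open MatrixLog (mlog)
open Summit.QuantumFields.YangMills.BalabanUVNodes.N09ChartReadAveragingSmooth
open Summit.QuantumFields.YangMills.BalabanUVNodes.N09ChartReadAveragingSubmersion
open Summit.QuantumFields.YangMills.BalabanUVNodes.N09AveragingOpenAtSmallFields (logChart_one)

variable {P : Params} {N : ℕ} [NeZero N]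

/-! ## §1 Bookkeeping: the translated chart, `Ū^{k+1} = Ū ∘ Ū^k` (`Λ 1 = 0` is ✓`N09AveragingOpenAtSmallFields.logChart_one`) -/

section Bookkeeping
/-- The translated product chart `A ↦ Θ^B(A)·U₀` is continuous. [cite: Helgason2000, Ch. I §1 Thm. 1.14 (13) p. 96 (bookkeeping)] -/
theorem continuous_piExpChart_translate {j : ℕ} (U₀ : GaugeField P j (SU N)) :
    Continuous fun A : PBond P j → (specialUnitaryLogChart (Fin N)).lie =>
      (fun b => (isChartRep_specialUnitaryGroup (n := Fin N)).expChart (A b) * U₀ b : GaugeField P j (SU N)) :=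
  continuous_pi fun b =>
    ((isChartRep_specialUnitaryGroup (n := Fin N)).continuous_expChart.comp (continuous_apply b)).mul continuous_const

/-- One more step of the iterate is one (0.4) averaging: `Ū^{k+1}(W) = Ū(Ū^k(W))` (`rfl`). [cite: Balaban1987RG1, (0.11) p.253 (bookkeeping)] -/
theorem iter_succ_eq (k : ℕ) (W : GaugeField P 0 (SU N)) :
    Averaging.iter (fun i => blockAvg (P := P) (j := i) (expMeanLogSU (n := Fin N))) (k + 1) W =
      avgFun (expMeanLogSU (n := Fin N)) (Averaging.iter (fun i => blockAvg (P := P) (j := i) (expMeanLogSU (n := Fin N))) k W) := rfl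

/-- The iterate of the chart centre is the iterate: `Ū^k(Θ^B(0)·U₀) = Ū^k(U₀)`. [cite: Balaban1987RG1, (0.11) p.253 (bookkeeping)] -/
theorem iter_piExpChart_translate_zero (k : ℕ) (U₀ : GaugeField P 0 (SU N)) :
    Averaging.iter (fun i => blockAvg (P := P) (j := i) (expMeanLogSU (n := Fin N))) k
        (fun b => (isChartRep_specialUnitaryGroup (n := Fin N)).expChart ((0 : PBond P 0 → (specialUnitaryLogChart (Fin N)).lie) b) * U₀ b) =
      Averaging.iter (fun i => blockAvg (P := P) (j := i) (expMeanLogSU (n := Fin N))) k U₀ := by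
  rw [piExpChart_translate_zero]

/-- The loop `α`-guard with `α < δ_N` at every level `< k` gives the (0.4) guard below `k`. [cite: Balaban1987RG1, (0.4) p.253 (bookkeeping)] -/
theorem smallBelow_of_loopGuard {k : ℕ} {U₀ : GaugeField P 0 (SU N)} {α : ℝ}
    (hα : ∀ i, i < k → ∀ (c : PBond P (i + 1)) (idx : Idx P),
      dist1 (loopHol (Averaging.iter (fun i => blockAvg (P := P) (j := i) (expMeanLogSU (n := Fin N))) i U₀) c idx) ≤ α)
    (hαδ : α < deltaSU (Fin N)) :
    SmallBelow (fun i => blockAvg (P := P) (j := i) (expMeanLogSU (n := Fin N))) k U₀ :=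
  fun i hi c idx => lt_of_le_of_lt (hα i hi c idx) hαδ

end Bookkeeping

/-! ## §2 Continuity of `A ↦ Ū^k(Θ^B(A)·U₀)` at `0` under the guard below `k`; the relative coarse bonds stay in the log chart -/

section Continuity
/-- ★ Under the (0.4) guard below `k`, `A ↦ Ū^k(Θ^B(A)·U₀)` is continuous at `A = 0` (the chart is continuous; the averaging is continuous at every guarded configuration,
✓`continuousAt_avgFun_of_small`, level by level). [cite: Balaban1987RG1, (0.4), (0.11) p.253] -/
theorem continuousAt_iter_chart (U₀ : GaugeField P 0 (SU N)) :
    ∀ k : ℕ, SmallBelow (fun i => blockAvg (P := P) (j := i) (expMeanLogSU (n := Fin N))) k U₀ →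
      ContinuousAt (fun A : PBond P 0 → (specialUnitaryLogChart (Fin N)).lie =>
        Averaging.iter (fun i => blockAvg (P := P) (j := i) (expMeanLogSU (n := Fin N))) k
          (fun b => (isChartRep_specialUnitaryGroup (n := Fin N)).expChart (A b) * U₀ b)) 0
  | 0, _ => (continuous_piExpChart_translate (P := P) (N := N) U₀).continuousAt
  | k + 1, h => by
    have ih := continuousAt_iter_chart U₀ k (h.mono (Nat.le_succ k))
    have hav : ContinuousAt (avgFun (expMeanLogSU (n := Fin N)) : GaugeField P k (SU N) → GaugeField P (k + 1) (SU N))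
        (Averaging.iter (fun i => blockAvg (P := P) (j := i) (expMeanLogSU (n := Fin N))) k U₀) :=
      continuousAt_avgFun_of_small _ (h k (Nat.lt_succ_self k))
    exact hav.comp_of_eq ih (iter_piExpChart_translate_zero (P := P) (N := N) k U₀)

/-- Near `A = 0` (guard below `k`) every relative coarse bond `Ū^k(Θ^B(A)·U₀)(c)·Ū^k(U₀)(c)⁻¹` is within the inner radius of the log chart of `1`.
[cite: Balaban1987RG1, (0.4), (0.11) p.253 (bookkeeping)] -/
theorem eventually_norm_rel_iter_lt (U₀ : GaugeField P 0 (SU N)) (k : ℕ)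
    (h : SmallBelow (fun i => blockAvg (P := P) (j := i) (expMeanLogSU (n := Fin N))) k U₀) :
    ∀ᶠ A in 𝓝 (0 : PBond P 0 → (specialUnitaryLogChart (Fin N)).lie), ∀ c : PBond P k,
      ‖((Averaging.iter (fun i => blockAvg (P := P) (j := i) (expMeanLogSU (n := Fin N))) k
            (fun b => (isChartRep_specialUnitaryGroup (n := Fin N)).expChart (A b) * U₀ b) c *
          (Averaging.iter (fun i => blockAvg (P := P) (j := i) (expMeanLogSU (n := Fin N))) k U₀ c)⁻¹ : SU N) : Matrix (Fin N) (Fin N) ℂ) - 1‖ <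
        innerRadius (specialUnitaryLogChart (Fin N)) := by
  have hc := continuousAt_iter_chart (P := P) (N := N) U₀ k h
  refine eventually_all.2 fun c => ?_
  have hcomp : ContinuousAt (fun A : PBond P 0 → (specialUnitaryLogChart (Fin N)).lie =>
      ‖((Averaging.iter (fun i => blockAvg (P := P) (j := i) (expMeanLogSU (n := Fin N))) k
            (fun b => (isChartRep_specialUnitaryGroup (n := Fin N)).expChart (A b) * U₀ b) c *
          (Averaging.iter (fun i => blockAvg (P := P) (j := i) (expMeanLogSU (n := Fin N))) k U₀ c)⁻¹ : SU N) : Matrix (Fin N) (Fin N) ℂ) - 1‖) 0 := by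
    have hW : ContinuousAt (fun W : GaugeField P k (SU N) => ‖((W c * (Averaging.iter (fun i => blockAvg (P := P) (j := i) (expMeanLogSU (n := Fin N))) k U₀ c)⁻¹ :
        SU N) : Matrix (Fin N) (Fin N) ℂ) - 1‖)
        (Averaging.iter (fun i => blockAvg (P := P) (j := i) (expMeanLogSU (n := Fin N))) k U₀) :=
      (continuous_norm.comp ((continuous_subtype_val.comp (((continuous_apply c).mul continuous_const))).sub
        continuous_const)).continuousAt
    exact hW.comp_of_eq hc (iter_piExpChart_translate_zero (P := P) (N := N) k U₀)
  refine hcomp.eventually (isOpen_Iio.mem_nhds ?_)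
  show ‖((Averaging.iter (fun i => blockAvg (P := P) (j := i) (expMeanLogSU (n := Fin N))) k
        (fun b => (isChartRep_specialUnitaryGroup (n := Fin N)).expChart ((0 : PBond P 0 → (specialUnitaryLogChart (Fin N)).lie) b) * U₀ b) c *
      (Averaging.iter (fun i => blockAvg (P := P) (j := i) (expMeanLogSU (n := Fin N))) k U₀ c)⁻¹ : SU N) : Matrix (Fin N) (Fin N) ℂ) - 1‖ < _
  rw [iter_piExpChart_translate_zero, mul_inv_cancel, OneMemClass.coe_one, sub_self, norm_zero]
  exact innerRadius_pos

/-- Inside the inner radius the chart-read iterate exponentiates back: `Θ(Ψ_k(A)(c))·Ū^k(U₀)(c) = Ū^k(Θ^B(A)·U₀)(c)` (`Θ ∘ Λ = id` on the window).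
[cite: Helgason2000, Ch. I §1 Thm. 1.14 (13) p. 96; Balaban1987RG1, (0.11) p.253] -/
theorem expChart_chartRead_iter_mul (U₀ : GaugeField P 0 (SU N)) (k : ℕ) {A : PBond P 0 → (specialUnitaryLogChart (Fin N)).lie}
    (hA : ∀ c : PBond P k,
      ‖((Averaging.iter (fun i => blockAvg (P := P) (j := i) (expMeanLogSU (n := Fin N))) k
            (fun b => (isChartRep_specialUnitaryGroup (n := Fin N)).expChart (A b) * U₀ b) c *
          (Averaging.iter (fun i => blockAvg (P := P) (j := i) (expMeanLogSU (n := Fin N))) k U₀ c)⁻¹ : SU N) : Matrix (Fin N) (Fin N) ℂ) - 1‖ <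
        innerRadius (specialUnitaryLogChart (Fin N))) :
    (fun c : PBond P k => (isChartRep_specialUnitaryGroup (n := Fin N)).expChart
        ((isChartRep_specialUnitaryGroup (n := Fin N)).logChart
          (Averaging.iter (fun i => blockAvg (P := P) (j := i) (expMeanLogSU (n := Fin N))) k
              (fun b => (isChartRep_specialUnitaryGroup (n := Fin N)).expChart (A b) * U₀ b) c *
            (Averaging.iter (fun i => blockAvg (P := P) (j := i) (expMeanLogSU (n := Fin N))) k U₀ c)⁻¹)) *
        Averaging.iter (fun i => blockAvg (P := P) (j := i) (expMeanLogSU (n := Fin N))) k U₀ c : GaugeField P k (SU N)) =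
      Averaging.iter (fun i => blockAvg (P := P) (j := i) (expMeanLogSU (n := Fin N))) k
        (fun b => (isChartRep_specialUnitaryGroup (n := Fin N)).expChart (A b) * U₀ b) := by
  funext c
  have hρ : ‖fundamentalRep (Fin N) (Averaging.iter (fun i => blockAvg (P := P) (j := i) (expMeanLogSU (n := Fin N))) k
        (fun b => (isChartRep_specialUnitaryGroup (n := Fin N)).expChart (A b) * U₀ b) c *
      (Averaging.iter (fun i => blockAvg (P := P) (j := i) (expMeanLogSU (n := Fin N))) k U₀ c)⁻¹) - 1‖ <
        innerRadius (specialUnitaryLogChart (Fin N)) := by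
    rw [fundamentalRep_apply]; exact hA c
  rw [(isChartRep_specialUnitaryGroup (n := Fin N)).expChart_logChart hρ, inv_mul_cancel_right]

end Continuity

/-! ## §3 The factorisation `Ψ_{k+1} = ψ_{Ū^k(U₀)} ∘ Ψ_k` near `0`, and `Ψ_0 = id` near `0` -/

section Factorisation
/-- `Ψ_k(0) = 0` (every relative coarse bond is `1`, `Λ 1 = 0`). [cite: Balaban1987RG1, (0.11) p.253 (bookkeeping)] -/
theorem chartRead_iter_apply_zero (U₀ : GaugeField P 0 (SU N)) (k : ℕ) :
    (fun c : PBond P k => (isChartRep_specialUnitaryGroup (n := Fin N)).logChart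
        (Averaging.iter (fun i => blockAvg (P := P) (j := i) (expMeanLogSU (n := Fin N))) k
            (fun b => (isChartRep_specialUnitaryGroup (n := Fin N)).expChart ((0 : PBond P 0 → (specialUnitaryLogChart (Fin N)).lie) b) * U₀ b) c *
          (Averaging.iter (fun i => blockAvg (P := P) (j := i) (expMeanLogSU (n := Fin N))) k U₀ c)⁻¹)) = 0 := by
  funext c
  rw [iter_piExpChart_translate_zero, mul_inv_cancel, Pi.zero_apply]
  exact logChart_one

/-- ★★ **THE FACTORISATION.**  Under the guard below `k`, near `A = 0`: `Ψ_{k+1}(A) = ψ_{Ū^k(U₀)}(Ψ_k(A))` — the `(k+1)`-step chart-read average IS N09's one-step chart-read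
average at the base `Ū^k(U₀)` applied to the `k`-step one (the intermediate chart round trip `Θ ∘ Λ = id` holds because the relative coarse bonds are near `1`).
[cite: Balaban1987RG1, (0.4), (0.11) p.253] -/
theorem chartRead_iter_succ_eventuallyEq (U₀ : GaugeField P 0 (SU N)) (k : ℕ)
    (h : SmallBelow (fun i => blockAvg (P := P) (j := i) (expMeanLogSU (n := Fin N))) k U₀) :
    (fun (A : PBond P 0 → (specialUnitaryLogChart (Fin N)).lie) (c' : PBond P (k + 1)) =>
        (isChartRep_specialUnitaryGroup (n := Fin N)).logChart
          (Averaging.iter (fun i => blockAvg (P := P) (j := i) (expMeanLogSU (n := Fin N))) (k + 1)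
              (fun b => (isChartRep_specialUnitaryGroup (n := Fin N)).expChart (A b) * U₀ b) c' *
            (Averaging.iter (fun i => blockAvg (P := P) (j := i) (expMeanLogSU (n := Fin N))) (k + 1) U₀ c')⁻¹)) =ᶠ[𝓝 0]
      (fun (B : PBond P k → (specialUnitaryLogChart (Fin N)).lie) (c' : PBond P (k + 1)) =>
          (isChartRep_specialUnitaryGroup (n := Fin N)).logChart
            (avgFun (expMeanLogSU (n := Fin N))
                (fun c => (isChartRep_specialUnitaryGroup (n := Fin N)).expChart (B c) *
                  Averaging.iter (fun i => blockAvg (P := P) (j := i) (expMeanLogSU (n := Fin N))) k U₀ c) c' *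
              (avgFun (expMeanLogSU (n := Fin N)) (Averaging.iter (fun i => blockAvg (P := P) (j := i) (expMeanLogSU (n := Fin N))) k U₀) c')⁻¹)) ∘
        (fun (A : PBond P 0 → (specialUnitaryLogChart (Fin N)).lie) (c : PBond P k) =>
          (isChartRep_specialUnitaryGroup (n := Fin N)).logChart
            (Averaging.iter (fun i => blockAvg (P := P) (j := i) (expMeanLogSU (n := Fin N))) k
                (fun b => (isChartRep_specialUnitaryGroup (n := Fin N)).expChart (A b) * U₀ b) c *
              (Averaging.iter (fun i => blockAvg (P := P) (j := i) (expMeanLogSU (n := Fin N))) k U₀ c)⁻¹)) := by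
  refine (eventually_norm_rel_iter_lt (P := P) (N := N) U₀ k h).mono fun A hA => ?_
  funext c'
  simp only [Function.comp_apply]
  rw [expChart_chartRead_iter_mul (P := P) (N := N) U₀ k hA]
  rfl

/-- `Ψ_0 = id` near `0`: at step zero the chart-read map is `A ↦ (b ↦ Λ(Θ(A b)·U₀ b·(U₀ b)⁻¹)) = A` on the ball of radius `chartRadius` (`Λ ∘ Θ = id` there).
[cite: Helgason2000, Ch. I §1 Thm. 1.14 (13) p. 96 (bookkeeping)] -/
theorem chartRead_iter_zero_eventuallyEq (U₀ : GaugeField P 0 (SU N)) :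
    (fun (A : PBond P 0 → (specialUnitaryLogChart (Fin N)).lie) (c : PBond P 0) =>
        (isChartRep_specialUnitaryGroup (n := Fin N)).logChart
          (Averaging.iter (fun i => blockAvg (P := P) (j := i) (expMeanLogSU (n := Fin N))) 0
              (fun b => (isChartRep_specialUnitaryGroup (n := Fin N)).expChart (A b) * U₀ b) c *
            (Averaging.iter (fun i => blockAvg (P := P) (j := i) (expMeanLogSU (n := Fin N))) 0 U₀ c)⁻¹)) =ᶠ[𝓝 0] id := by
  have hball : Metric.ball (0 : PBond P 0 → (specialUnitaryLogChart (Fin N)).lie) (chartRadius (specialUnitaryLogChart (Fin N))) ∈ 𝓝 0 :=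
    Metric.ball_mem_nhds 0 chartRadius_pos
  refine Filter.mem_of_superset hball fun A hA => ?_
  rw [mem_ball_zero_iff] at hA
  funext c
  show (isChartRep_specialUnitaryGroup (n := Fin N)).logChart
      ((isChartRep_specialUnitaryGroup (n := Fin N)).expChart (A c) * U₀ c * (U₀ c)⁻¹) = A c
  rw [mul_inv_cancel_right]
  exact (isChartRep_specialUnitaryGroup (n := Fin N)).logChart_expChart (lt_of_le_of_lt (norm_le_pi_norm A c) hA)

end Factorisation

/-! ## §4 The induction: `Ψ_k` is `C^∞` at `0` with ONTO derivative, under the loop guard at every level `< k` -/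

section Onto
/-- ★★★ **THE k-STEP CHART-READ AVERAGE IS `C^∞` AT `0` WITH ONTO DERIVATIVE** (induction on `k`: `Ψ_0 = id` near `0`; `Ψ_{k+1} = ψ_{Ū^k(U₀)} ∘ Ψ_k` near `0` with
`ψ_{Ū^k(U₀)}` `C^∞` at `0 = Ψ_k(0)` (✓`contDiffAt_chartRead_avgFun`) and `range Dψ_{Ū^k(U₀)}(0) = ⊤` (✓`fderiv_chartRead_avgFun_range_eq_top`); chain rule; the range of a
composite of onto linear maps is `⊤`).  Hypotheses: the standing range `k ≤ m + K` and the loop `α`-guard at every level `i < k` with N09's numerics.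
[cite: Balaban1987RG1, (0.4), (0.8), (0.11) p.253; Balaban1985Averaging, Prop. 3 (122)-(124) p.36] -/
theorem contDiffAt_and_range_fderiv_chartRead_iter (U₀ : GaugeField P 0 (SU N)) {α : ℝ} (hα24 : α ≤ 1 / 24) (hαδ : α < deltaSU (Fin N))
    (hαL : 157 * α < ((P.L : ℝ) ^ (P.d - 1))⁻¹) :
    ∀ k : ℕ, k ≤ P.m + P.K →
      (∀ i, i < k → ∀ (c : PBond P (i + 1)) (idx : Idx P),
        dist1 (loopHol (Averaging.iter (fun i => blockAvg (P := P) (j := i) (expMeanLogSU (n := Fin N))) i U₀) c idx) ≤ α) →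
      ContDiffAt ℝ ⊤ (fun (A : PBond P 0 → (specialUnitaryLogChart (Fin N)).lie) (c : PBond P k) =>
          (isChartRep_specialUnitaryGroup (n := Fin N)).logChart
            (Averaging.iter (fun i => blockAvg (P := P) (j := i) (expMeanLogSU (n := Fin N))) k
                (fun b => (isChartRep_specialUnitaryGroup (n := Fin N)).expChart (A b) * U₀ b) c *
              (Averaging.iter (fun i => blockAvg (P := P) (j := i) (expMeanLogSU (n := Fin N))) k U₀ c)⁻¹)) 0 ∧
        LinearMap.range ((fderiv ℝ (fun (A : PBond P 0 → (specialUnitaryLogChart (Fin N)).lie) (c : PBond P k) =>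
          (isChartRep_specialUnitaryGroup (n := Fin N)).logChart
            (Averaging.iter (fun i => blockAvg (P := P) (j := i) (expMeanLogSU (n := Fin N))) k
                (fun b => (isChartRep_specialUnitaryGroup (n := Fin N)).expChart (A b) * U₀ b) c *
              (Averaging.iter (fun i => blockAvg (P := P) (j := i) (expMeanLogSU (n := Fin N))) k U₀ c)⁻¹)) 0 :
            (PBond P 0 → (specialUnitaryLogChart (Fin N)).lie) →L[ℝ] (PBond P k → (specialUnitaryLogChart (Fin N)).lie)) :
            (PBond P 0 → (specialUnitaryLogChart (Fin N)).lie) →ₗ[ℝ] (PBond P k → (specialUnitaryLogChart (Fin N)).lie)) = ⊤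
  | 0, _, _ => by
    have hid := chartRead_iter_zero_eventuallyEq (P := P) (N := N) U₀
    refine ⟨contDiffAt_id.congr_of_eventuallyEq hid, ?_⟩
    have hD : HasFDerivAt (fun (A : PBond P 0 → (specialUnitaryLogChart (Fin N)).lie) (c : PBond P 0) =>
        (isChartRep_specialUnitaryGroup (n := Fin N)).logChart
          (Averaging.iter (fun i => blockAvg (P := P) (j := i) (expMeanLogSU (n := Fin N))) 0
              (fun b => (isChartRep_specialUnitaryGroup (n := Fin N)).expChart (A b) * U₀ b) c *
            (Averaging.iter (fun i => blockAvg (P := P) (j := i) (expMeanLogSU (n := Fin N))) 0 U₀ c)⁻¹))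
        (ContinuousLinearMap.id ℝ (PBond P 0 → (specialUnitaryLogChart (Fin N)).lie)) 0 :=
      (hasFDerivAt_id (𝕜 := ℝ) (0 : PBond P 0 → (specialUnitaryLogChart (Fin N)).lie)).congr_of_eventuallyEq hid
    rw [hD.fderiv, ContinuousLinearMap.coe_id, LinearMap.range_id]
  | k + 1, hk, hα => by
    -- the guard below `k + 1`, the induction hypothesis at `k`
    have hsb : SmallBelow (fun i => blockAvg (P := P) (j := i) (expMeanLogSU (n := Fin N))) (k + 1) U₀ :=
      smallBelow_of_loopGuard (P := P) (N := N) hα hαδ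
    obtain ⟨ihC, ihR⟩ := contDiffAt_and_range_fderiv_chartRead_iter U₀ hα24 hαδ hαL k (Nat.le_of_succ_le hk)
      (fun i hi c idx => hα i (Nat.lt_succ_of_lt hi) c idx)
    -- the one-step chart-read average at the base `Ū^k(U₀)`
    set Uk : GaugeField P k (SU N) := Averaging.iter (fun i => blockAvg (P := P) (j := i) (expMeanLogSU (n := Fin N))) k U₀ with hUk
    have hsmallk : ∀ c, Small (expMeanLogSU (n := Fin N)) Uk c := fun c => hsb k (Nat.lt_succ_self k) c
    have hψC : ContDiffAt ℝ ⊤ (fun (B : PBond P k → (specialUnitaryLogChart (Fin N)).lie) (c' : PBond P (k + 1)) =>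
        (isChartRep_specialUnitaryGroup (n := Fin N)).logChart
          (avgFun (expMeanLogSU (n := Fin N)) (fun c => (isChartRep_specialUnitaryGroup (n := Fin N)).expChart (B c) * Uk c) c' *
            (avgFun (expMeanLogSU (n := Fin N)) Uk c')⁻¹)) 0 :=
      contDiffAt_chartRead_avgFun (P := P) (j := k) Uk hsmallk
    have hψR := fderiv_chartRead_avgFun_range_eq_top (P := P) (j := k) (U₀ := Uk) hk (hα k (Nat.lt_succ_self k)) hα24 hαδ hαL
    -- the factorisation near `0` and the value `Ψ_k(0) = 0`
    have hfac := chartRead_iter_succ_eventuallyEq (P := P) (N := N) U₀ k (hsb.mono (Nat.le_succ k))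
    have h0 := chartRead_iter_apply_zero (P := P) (N := N) U₀ k
    set Ψk := fun (A : PBond P 0 → (specialUnitaryLogChart (Fin N)).lie) (c : PBond P k) =>
      (isChartRep_specialUnitaryGroup (n := Fin N)).logChart
        (Averaging.iter (fun i => blockAvg (P := P) (j := i) (expMeanLogSU (n := Fin N))) k
            (fun b => (isChartRep_specialUnitaryGroup (n := Fin N)).expChart (A b) * U₀ b) c *
          (Averaging.iter (fun i => blockAvg (P := P) (j := i) (expMeanLogSU (n := Fin N))) k U₀ c)⁻¹) with hΨk
    set ψ := fun (B : PBond P k → (specialUnitaryLogChart (Fin N)).lie) (c' : PBond P (k + 1)) =>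
        (isChartRep_specialUnitaryGroup (n := Fin N)).logChart
          (avgFun (expMeanLogSU (n := Fin N)) (fun c => (isChartRep_specialUnitaryGroup (n := Fin N)).expChart (B c) * Uk c) c' *
            (avgFun (expMeanLogSU (n := Fin N)) Uk c')⁻¹) with hψ
    have hΨk0 : Ψk 0 = 0 := h0
    have hψC' : ContDiffAt ℝ ⊤ ψ (Ψk 0) := by rw [hΨk0]; exact hψC
    refine ⟨(hψC'.comp 0 ihC).congr_of_eventuallyEq hfac, ?_⟩
    -- chain rule
    have hΨkD : HasFDerivAt Ψk (fderiv ℝ Ψk 0) 0 := (ihC.differentiableAt (by simp)).hasFDerivAt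
    have hψD : HasFDerivAt ψ (fderiv ℝ ψ 0) (Ψk 0) := by
      rw [hΨk0]; exact (hψC.differentiableAt (by simp)).hasFDerivAt
    have hcomp : HasFDerivAt (ψ ∘ Ψk) ((fderiv ℝ ψ 0).comp (fderiv ℝ Ψk 0)) 0 :=
      HasFDerivAt.comp (𝕜 := ℝ) (f := Ψk) (f' := fderiv ℝ Ψk 0) (g := ψ) (g' := fderiv ℝ ψ 0)
        (0 : PBond P 0 → (specialUnitaryLogChart (Fin N)).lie) hψD hΨkD
    have hD := hcomp.congr_of_eventuallyEq hfac
    rw [hD.fderiv, ContinuousLinearMap.toLinearMap_comp, LinearMap.range_comp_of_range_eq_top _ ihR]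
    exact hψR

/-- ★★★ **(s2) «`DM` ONTO», RANGE FORM.**  For every `U₀ : GaugeField P 0 (SU N)` whose iterated averages `Ū^i(U₀)`, `i < k ≤ m + K`, satisfy the loop `α`-guard
(`α ≤ 1∕24`, `α < δ_N`, `157·α < L^{1−d}`): `range (fderiv ℝ Ψ_k 0) = ⊤` for the k-step chart-read average `Ψ_k(A)(c) = Λ(Ū^k(Θ^B(A)·U₀)(c)·Ū^k(U₀)(c)⁻¹)`.
[cite: Balaban1987RG1, (0.4), (0.8), (0.11) p.253; Balaban1985Averaging, Prop. 3 (122)-(124) p.36] -/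
theorem range_fderiv_chartRead_iter_eq_top (U₀ : GaugeField P 0 (SU N)) {k : ℕ} (hk : k ≤ P.m + P.K) {α : ℝ}
    (hα : ∀ i, i < k → ∀ (c : PBond P (i + 1)) (idx : Idx P),
      dist1 (loopHol (Averaging.iter (fun i => blockAvg (P := P) (j := i) (expMeanLogSU (n := Fin N))) i U₀) c idx) ≤ α)
    (hα24 : α ≤ 1 / 24) (hαδ : α < deltaSU (Fin N)) (hαL : 157 * α < ((P.L : ℝ) ^ (P.d - 1))⁻¹) :
    LinearMap.range ((fderiv ℝ (fun (A : PBond P 0 → (specialUnitaryLogChart (Fin N)).lie) (c : PBond P k) =>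
        (isChartRep_specialUnitaryGroup (n := Fin N)).logChart
          (Averaging.iter (fun i => blockAvg (P := P) (j := i) (expMeanLogSU (n := Fin N))) k
              (fun b => (isChartRep_specialUnitaryGroup (n := Fin N)).expChart (A b) * U₀ b) c *
            (Averaging.iter (fun i => blockAvg (P := P) (j := i) (expMeanLogSU (n := Fin N))) k U₀ c)⁻¹)) 0 :
          (PBond P 0 → (specialUnitaryLogChart (Fin N)).lie) →L[ℝ] (PBond P k → (specialUnitaryLogChart (Fin N)).lie)) :
          (PBond P 0 → (specialUnitaryLogChart (Fin N)).lie) →ₗ[ℝ] (PBond P k → (specialUnitaryLogChart (Fin N)).lie)) = ⊤ :=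
  (contDiffAt_and_range_fderiv_chartRead_iter (P := P) (N := N) U₀ hα24 hαδ hαL k hk hα).2

/-- ★★★ **(s2) «`DM` ONTO», SURJECTIVITY FORM** (the shape of ✓`…S2BetaCritMOfSubmersion`'s `hsurj`). [cite: Balaban1987RG1, (0.4), (0.8), (0.11) p.253; Balaban1985Averaging, Prop. 3 (124) p.36] -/
theorem surjective_fderiv_chartRead_iter (U₀ : GaugeField P 0 (SU N)) {k : ℕ} (hk : k ≤ P.m + P.K) {α : ℝ}
    (hα : ∀ i, i < k → ∀ (c : PBond P (i + 1)) (idx : Idx P),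
      dist1 (loopHol (Averaging.iter (fun i => blockAvg (P := P) (j := i) (expMeanLogSU (n := Fin N))) i U₀) c idx) ≤ α)
    (hα24 : α ≤ 1 / 24) (hαδ : α < deltaSU (Fin N)) (hαL : 157 * α < ((P.L : ℝ) ^ (P.d - 1))⁻¹) :
    Function.Surjective (fderiv ℝ (fun (A : PBond P 0 → (specialUnitaryLogChart (Fin N)).lie) (c : PBond P k) =>
        (isChartRep_specialUnitaryGroup (n := Fin N)).logChart
          (Averaging.iter (fun i => blockAvg (P := P) (j := i) (expMeanLogSU (n := Fin N))) k
              (fun b => (isChartRep_specialUnitaryGroup (n := Fin N)).expChart (A b) * U₀ b) c *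
            (Averaging.iter (fun i => blockAvg (P := P) (j := i) (expMeanLogSU (n := Fin N))) k U₀ c)⁻¹)) 0) := by
  have h := range_fderiv_chartRead_iter_eq_top (P := P) (N := N) U₀ hk hα hα24 hαδ hαL
  rw [LinearMap.range_eq_top] at h
  exact h

/-- `Ψ_k` is `C^∞` at `0` under the (0.4) guard below `k` alone (no `α`-numerics, no standing range: the factorisation and ✓`contDiffAt_chartRead_avgFun`).
[cite: Balaban1987RG1, (0.4) p.253 («analytic function»), (0.11) p.253] -/
theorem contDiffAt_chartRead_iter (U₀ : GaugeField P 0 (SU N)) :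
    ∀ k : ℕ, SmallBelow (fun i => blockAvg (P := P) (j := i) (expMeanLogSU (n := Fin N))) k U₀ →
      ContDiffAt ℝ ⊤ (fun (A : PBond P 0 → (specialUnitaryLogChart (Fin N)).lie) (c : PBond P k) =>
          (isChartRep_specialUnitaryGroup (n := Fin N)).logChart
            (Averaging.iter (fun i => blockAvg (P := P) (j := i) (expMeanLogSU (n := Fin N))) k
                (fun b => (isChartRep_specialUnitaryGroup (n := Fin N)).expChart (A b) * U₀ b) c *
              (Averaging.iter (fun i => blockAvg (P := P) (j := i) (expMeanLogSU (n := Fin N))) k U₀ c)⁻¹)) 0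
  | 0, _ => contDiffAt_id.congr_of_eventuallyEq (chartRead_iter_zero_eventuallyEq (P := P) (N := N) U₀)
  | k + 1, hsb => by
    have ihC := contDiffAt_chartRead_iter U₀ k (hsb.mono (Nat.le_succ k))
    set Uk : GaugeField P k (SU N) := Averaging.iter (fun i => blockAvg (P := P) (j := i) (expMeanLogSU (n := Fin N))) k U₀ with hUk
    have hψC : ContDiffAt ℝ ⊤ (fun (B : PBond P k → (specialUnitaryLogChart (Fin N)).lie) (c' : PBond P (k + 1)) =>
        (isChartRep_specialUnitaryGroup (n := Fin N)).logChart
          (avgFun (expMeanLogSU (n := Fin N)) (fun c => (isChartRep_specialUnitaryGroup (n := Fin N)).expChart (B c) * Uk c) c' *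
            (avgFun (expMeanLogSU (n := Fin N)) Uk c')⁻¹)) 0 :=
      contDiffAt_chartRead_avgFun (P := P) (j := k) Uk (fun c => hsb k (Nat.lt_succ_self k) c)
    have hfac := chartRead_iter_succ_eventuallyEq (P := P) (N := N) U₀ k (hsb.mono (Nat.le_succ k))
    have h0 := chartRead_iter_apply_zero (P := P) (N := N) U₀ k
    set Ψk := fun (A : PBond P 0 → (specialUnitaryLogChart (Fin N)).lie) (c : PBond P k) =>
      (isChartRep_specialUnitaryGroup (n := Fin N)).logChart
        (Averaging.iter (fun i => blockAvg (P := P) (j := i) (expMeanLogSU (n := Fin N))) k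
            (fun b => (isChartRep_specialUnitaryGroup (n := Fin N)).expChart (A b) * U₀ b) c *
          (Averaging.iter (fun i => blockAvg (P := P) (j := i) (expMeanLogSU (n := Fin N))) k U₀ c)⁻¹) with hΨk
    have hΨk0 : Ψk 0 = 0 := h0
    have hψC' : ContDiffAt ℝ ⊤ (fun (B : PBond P k → (specialUnitaryLogChart (Fin N)).lie) (c' : PBond P (k + 1)) =>
        (isChartRep_specialUnitaryGroup (n := Fin N)).logChart
          (avgFun (expMeanLogSU (n := Fin N)) (fun c => (isChartRep_specialUnitaryGroup (n := Fin N)).expChart (B c) * Uk c) c' *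
            (avgFun (expMeanLogSU (n := Fin N)) Uk c')⁻¹)) (Ψk 0) := by rw [hΨk0]; exact hψC
    exact (hψC'.comp 0 ihC).congr_of_eventuallyEq hfac

/-- ★★ **STRICT DIFFERENTIABILITY WITH ONTO DERIVATIVE** — the pair `(HasStrictFDerivAt Ψ_k (fderiv ℝ Ψ_k 0) 0, Surjective (fderiv ℝ Ψ_k 0))` that a submersion ∕ Lagrange door
consumes (✓`…S2BetaCritMOfSubmersion.exists_multiplier_of_subm`'s `hMc`∕`hsurj` shape, in the log-chart conventions). [cite: Balaban1987RG1, (0.4), (0.8), (0.11) p.253;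
Balaban1985Variational, (3) p.278, (44) p.285] -/
theorem hasStrictFDerivAt_chartRead_iter (U₀ : GaugeField P 0 (SU N)) {k : ℕ} (hk : k ≤ P.m + P.K) {α : ℝ}
    (hα : ∀ i, i < k → ∀ (c : PBond P (i + 1)) (idx : Idx P),
      dist1 (loopHol (Averaging.iter (fun i => blockAvg (P := P) (j := i) (expMeanLogSU (n := Fin N))) i U₀) c idx) ≤ α)
    (hα24 : α ≤ 1 / 24) (hαδ : α < deltaSU (Fin N)) (hαL : 157 * α < ((P.L : ℝ) ^ (P.d - 1))⁻¹) :
    HasStrictFDerivAt (fun (A : PBond P 0 → (specialUnitaryLogChart (Fin N)).lie) (c : PBond P k) =>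
        (isChartRep_specialUnitaryGroup (n := Fin N)).logChart
          (Averaging.iter (fun i => blockAvg (P := P) (j := i) (expMeanLogSU (n := Fin N))) k
              (fun b => (isChartRep_specialUnitaryGroup (n := Fin N)).expChart (A b) * U₀ b) c *
            (Averaging.iter (fun i => blockAvg (P := P) (j := i) (expMeanLogSU (n := Fin N))) k U₀ c)⁻¹))
      (fderiv ℝ (fun (A : PBond P 0 → (specialUnitaryLogChart (Fin N)).lie) (c : PBond P k) =>
        (isChartRep_specialUnitaryGroup (n := Fin N)).logChart
          (Averaging.iter (fun i => blockAvg (P := P) (j := i) (expMeanLogSU (n := Fin N))) k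
              (fun b => (isChartRep_specialUnitaryGroup (n := Fin N)).expChart (A b) * U₀ b) c *
            (Averaging.iter (fun i => blockAvg (P := P) (j := i) (expMeanLogSU (n := Fin N))) k U₀ c)⁻¹)) 0) 0 ∧
    Function.Surjective (fderiv ℝ (fun (A : PBond P 0 → (specialUnitaryLogChart (Fin N)).lie) (c : PBond P k) =>
        (isChartRep_specialUnitaryGroup (n := Fin N)).logChart
          (Averaging.iter (fun i => blockAvg (P := P) (j := i) (expMeanLogSU (n := Fin N))) k
              (fun b => (isChartRep_specialUnitaryGroup (n := Fin N)).expChart (A b) * U₀ b) c *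
            (Averaging.iter (fun i => blockAvg (P := P) (j := i) (expMeanLogSU (n := Fin N))) k U₀ c)⁻¹)) 0) := by
  have h := contDiffAt_and_range_fderiv_chartRead_iter (P := P) (N := N) U₀ hα24 hαδ hαL k hk hα
  refine ⟨(h.1.hasStrictFDerivAt (by simp)), ?_⟩
  have h2 := h.2
  rw [LinearMap.range_eq_top] at h2
  exact h2

end Onto

end Summit.QuantumFields.YangMills.Theorems.FluctuationComparisonRegPrIntLS2BetaChartReadDescentOnto

end
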